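import Summits.CriticalPhenomena.PercolationContinuityZ3.Theorems.Transplant.SkelFrmFromBFaceHoldsQ3VOf
import Summits.CriticalPhenomena.PercolationContinuityZ3.Theorems.Transplant.SkelFrmFromBFaceBVC5Px
import HarnessLib

/-!
# U_s execution (RULING D-Us / Us-R9, lead g22 2026-08-26; WAVE-Us-MANIFEST v1.0 §3 GEN row «SkelFrmBFaceHoldsQ3VOf» ↦ «SkelFrmFromBFaceHoldsQ3VOfPx»):
# **the (F) column's layers (a6)/(a7) UNDER PROXIES** — `PlanarSkeletonFrmFrom.NegB.faceOblRM_frmBVC₆Px` / `faceOblRM_frmBVC₇Px`, the GEN twins of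
# «SkelFrmFromBFaceHoldsQ3VOf»'s private `faceOblRM_frmBVC₆'` / `₇'`, over hp-8 g57's «SkelFrmFromBFaceBVC5Px» (`faceOblRM_frmBVC₅Px`)

builds on p205010 (kernel theorem, internal audit signed; external expert review pending) — nothing in this file uses p205010; NOTHING is claimed about the
OPEN node U_s `SamePDropOfSkeletonFrmScaled₁` (U is CLOSED, «SkelFrmFrom1HoldsAll», untouched).  Lane `prim-bschramm`, seat `prim-bschramm-stmt` gen 29 (port pen
by RULING Us-R9); helper file (`--supports stmt-CriticalPhenomena-4575 --as helper`); NON-VERBATIM GEN row in the (F) PORT SHAPE OF RECORD (design owner p3 g27,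
bus 2026-08-27T00:11Z: PLAIN slots `KS.gT mkP gx / KS.fT mkP fx` at an index BINDER `mkP`, the U `hAt`/`scheme`/`FD` shapes at `mkP`; the tuple's record-dependent
index is met ONLY in the (F) top through «SkelFrmFromBChoiceSlotCongrPx»).  HUNKS vs the U twin: (i) `(h1) ↦ {D} (hP : Φ.HasProxies t D)` + floors `hnL`,
`hnK : D ≤ n_kit mk`, `hDk : D ≤ k`, `hnBF : D ≤ nBF cW mkP`; (k2) binders `(mk mkP cW : ℕ)` with `hRK : KS.RK t O.merged mk + D ≤ KS.RK t O.merged mkP` — EVERY kit /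
slot / face-kit head of the U text read at `mkP` (token `mk ↦ mkP`), the served region at `mk` (consumed in «…BFaceBVC3Px»); (iii) zones `Λ c ↦ Λ (hP.prox c)` at the
seed level in (a6)'s lattice-functional bound (same cylinders by `HasProxies.oriφ_prox`) and in (a5)'s `hZk`; (iv) long radius `RL ↦ RL + D` (`hRlr`, `hRr₀`, `hr₂R`,
`hR₁r`), face-bridge radius `R_bF ↦ R_bF + D` (`hRb₀`, `hr₁R`, `hR₁b`), rim radius `fatRadius k ↦ D + fatRadius k` (`hρr`, `hR₁b`, `hR₁r`) — all DISCHARGED in (a7)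
WITHOUT a new slot floor (`r₀0 (X + D) ≤ r₀0 X + D`, `D ≤ k ≤ fatRadius k = ψπ`, slack `3ψπ` of `L′(SUS)`; hp-8 g57 / p3 g27 bus 00:39Z/00:43Z: no `exRD` member
needed, the TUPLE Px OF RECORD stands).  Every slot-floor binder keeps U's ∀-record FORM at the fixed index `mkP` (design-owner ruling 00:45Z; the (F) top hands this
layer FIXED-index slots after swapping the tuple's three record-dependent slots at `(O, q)`).  The U Fn-level wrapper
`faceHoldsRNQFnLTK_frmChoiceAllQ3V_of` has NO twin here: its rôle passes to the (F) top (gen-1 g2, RULING Us-R10).  Conclusions: the U twins', at `mkP`.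
[cite: KozmaNitzan2024, §4 Lemma 11–12 (pp. 21–25), Theorem 6 (pp. 25–31)] [cite: MartineauTassion2017, §4.3] [cite: BenjaminiSchramm1996, Conj. 4] [this work]
-/

noncomputable section

open scoped Classical ENNReal

namespace Summit.CriticalPhenomena.PercolationContinuityZ3.Theorems.Transplant

namespace PlanarSkeletonFrmFrom

namespace NegB

open MeasureTheory Literature.Probability.Percolation Literature.Probability.LatticeModels SimpleGraph KNCells KNLevels GadgetSystem Contour
open Literature.Probability.Percolation.KozmaNitzan
open Literature.Probability.Percolation.KozmaNitzan.Cells (oth sgOf sgOf_sign stepVec_apply_fst)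
open Literature.Barriers.CriticalPhenomena (graphBall mem_graphBall_self graphBall_mono)
open BoxProdZ2 (ConcRadiiG Erad Frad nQ nS)
open ChainPlanar ChainPara
open Skel (winGraph routeW excess WinStepData)
open SkelI (tanOff)
open TwoAxis.Para (modulus detD rep₂)
open SkelConc (Consts)
open Skelφ
open Skelφ.StepI (DataNS OutNS)
open Neg

variable {κ : Consts} {V : Type} [DecidableEq V] [Countable V] {G : SimpleGraph V} [G.LocallyFinite] {Φ : PlanarSkeletonFrmFrom G} {t : V}
  {p : unitInterval} {Pv : NegB.PSlot} {cv hv : NegB.CSlot} {hC : Φ.CylSubcritical p}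
  {O : OutNS V} {q : unitInterval}

/-! ## §1 Layer (a6) under proxies -/

set_option maxHeartbeats 3200000 in
/-- **Layer (a6) of the (F) wrapper UNDER PROXIES: the numbers batch's frame, zone and band rows discharged** — GEN twin of «SkelFrmFromBFaceHoldsQ3VOf»'s
private `faceOblRM_frmBVC₆'` in the (F) PORT SHAPE OF RECORD (plain slots `KS.gT mkP gx / KS.fT mkP fx` at the RAISED kit index `mkP`, served region at `mk`,
`hRK : RK mk + D ≤ RK mkP`): every U row read at `mkP` verbatim (frame rooms at the band, band rows, the zone bound through the two lattice functionals — for the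
zone family `Λ ∘ prox`, whose cylinders are the U cylinders by `HasProxies.oriφ_prox`), then hp-8 g57's layer (a5) `faceOblRM_frmBVC₅Px` BY NAME.
[cite: KozmaNitzan2024, §4 Lemma 12 (pp. 23–25)] -/
theorem faceOblRM_frmBVC₆Px {κ : Consts} {V : Type} [DecidableEq V] [Countable V] {G : SimpleGraph V} [G.LocallyFinite] {Φ : PlanarSkeletonFrmFrom G} {t : V} {p : unitInterval} {Pv : NegB.PSlot} {cv : NegB.CSlot} {hv : NegB.CSlot} {hC : Φ.CylSubcritical p} {O : OutNS V} {q : unitInterval}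
    (mk mkP cW : ℕ)
    (gx fx : Neg.FSlot)
    (hgx : ∀ D : DataNS V, gxFc mkP cW κ Φ t p D ≤ gx κ Φ t p D)
    (hfx : ∀ D : DataNS V, fxFc mkP κ Φ t p D ≤ fx κ Φ t p D)
    (ex mx : GSlot)
    (hmx : (prFA κ Φ t p O.merged (KS.gT mkP gx κ Φ t p O.merged) (KS.fT mkP fx κ Φ t p O.merged)).mF (fcellsA κ Φ t p O.merged (KS.gT mkP gx κ Φ t p O.merged) (KS.fT mkP fx κ Φ t p O.merged)) ≤ (((mx κ Φ t p O.merged (KS.gT mkP gx κ Φ t p O.merged) (KS.fT mkP fx κ Φ t p O.merged)) : ℕ) : ℤ))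
    (hAt : (choiceAtQ3V κ Φ t p Pv (KS.gT mkP gx) (KS.fT mkP fx) (SUS ex mx) cv hv BSlot.small3 hC).AtQNQ O q)
    {D : ℕ} (hP : Φ.HasProxies t D)
    -- UNDER PROXIES: the width floors (C-4) and the RAISED KIT INDEX `mkP` (K-2: same record, `RK mk + D ≤ RK mkP`; the served region / zone prism stays at `mk`)
    (hDk : D ≤ O.merged.k) (hnK : D ≤ KS.nKit O.merged mk) (hDnL : D ≤ (nL κ Φ t p O.merged (KS.gT mkP gx κ Φ t p O.merged) (KS.fT mkP fx κ Φ t p O.merged)))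
    (hnBF : D ≤ KS.nBF κ Φ t p O.merged cW mkP)
    (hRK : KS.RK t O.merged mk + D ≤ KS.RK t O.merged mkP)
    (hp0 : 0 < (p : ℝ))
    (hp1 : (p : ℝ) < 1)
    (hMR0 : 4 * Neg.K κ * (KS0.R'0 κ Φ t p O.merged mkP + 2) ≤ ML κ Φ t p O.merged (KS.gT mkP gx κ Φ t p O.merged))
    (hPx : ((KS.MBF κ Φ t p O.merged cW mkP), (KS.nBF κ Φ t p O.merged cW mkP)) ∈ (Pv κ Φ t p O.merged).1)
    (Lf : ℕ → ℕ)
    (hCF : ChainFactQT Lf G Φ.Δ κ (κ.δ₂ ^ 3))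
    -- the binders of `faceOblRM_fineNb2V` (schemeO side)
    (hL' : 1 ≤ (Skelφ.Prm.Lp ((SUS ex mx) κ Φ t p O.merged (KS.gT mkP gx κ Φ t p O.merged) (KS.fT mkP fx κ Φ t p O.merged) q)))
    -- the binders of the keystone `hkits_faceSteps_of_nums6` (kit / route / Λ / numbers)
    {r : ℕ}
    -- THE ROUTE BLOCK (c-uniform; all signs)
    (hRlr : (RL κ Φ t p O (KS.gT mkP gx) (KS.fT mkP fx) + D) ≤ r)
    -- the near-`c` block READ BY THE TWO LATTICE FUNCTIONALS (L-F2): bridge regions (every frame sign), hop prism, zone box, fine extents `kA`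
    (nB : ℕ)
    -- the inner-chain fact UP TO THE LENGTH BUDGET `nF` (p3-g11 2026-08-22T02:23:54Z; the wrapper discharges it by `ChainFactF` at `n ≤ LfA K₀`)
    (hRb₀ : (KS0.kit0 t O.merged mkP ((((Mu O.merged)) : ℤ) + 2) (KS0.r₀0 t O.merged mkP (O.merged.R (O.merged.scale t (KS.MBF κ Φ t p O.merged cW mkP) (KS.nBF κ Φ t p O.merged cW mkP)) + D))).r₀ ≤ r)
    (hr₁R : (O.merged.R (O.merged.scale t (KS.MBF κ Φ t p O.merged cW mkP) (KS.nBF κ Φ t p O.merged cW mkP)) + D) ≤ r)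
    (hRr₀ : (KS0.kit0 t O.merged mkP (((((Mu O.merged)) + 1 : ℕ) : ℤ) * ((shearUnit (nL κ Φ t p O.merged (KS.gT mkP gx κ Φ t p O.merged) (KS.fT mkP fx κ Φ t p O.merged)) (prFA κ Φ t p O.merged (KS.gT mkP gx κ Φ t p O.merged) (KS.fT mkP fx κ Φ t p O.merged)).h) : ℤ) + 1) (KS0.r₀0 t O.merged mkP (RL κ Φ t p O (KS.gT mkP gx) (KS.fT mkP fx) + D))).r₀ ≤ r)
    (hr₂R : (RL κ Φ t p O (KS.gT mkP gx) (KS.fT mkP fx) + D) ≤ r)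
    -- the short region and the zone datum at the kit centres ((S0): inside `Rg`, connected, containing the centre and the fat-prism box `cylBallFin c kz Rk`)
    (hRsr : (KS.Rs t O.merged mkP) ≤ r)
    (hρr : (D + Skelφ.fatRadius Φ.frame hC O.merged.k) ≤ r)
    (hR₁b : ((SUS ex mx κ Φ t p O.merged (KS.gT mkP gx κ Φ t p O.merged) (KS.fT mkP fx κ Φ t p O.merged) q).Rex (D + Skelφ.fatRadius Φ.frame hC O.merged.k)) ≤ r - (KS0.kit0 t O.merged mkP ((((Mu O.merged)) : ℤ) + 2) (KS0.r₀0 t O.merged mkP (O.merged.R (O.merged.scale t (KS.MBF κ Φ t p O.merged cW mkP) (KS.nBF κ Φ t p O.merged cW mkP)) + D))).r₀)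
    (hR₁r : ((SUS ex mx κ Φ t p O.merged (KS.gT mkP gx κ Φ t p O.merged) (KS.fT mkP fx κ Φ t p O.merged) q).Rex (D + Skelφ.fatRadius Φ.frame hC O.merged.k)) ≤ r - (KS0.kit0 t O.merged mkP (((((Mu O.merged)) + 1 : ℕ) : ℤ) * ((shearUnit (nL κ Φ t p O.merged (KS.gT mkP gx κ Φ t p O.merged) (KS.fT mkP fx κ Φ t p O.merged)) (prFA κ Φ t p O.merged (KS.gT mkP gx κ Φ t p O.merged) (KS.fT mkP fx κ Φ t p O.merged)).h) : ℤ) + 1) (KS0.r₀0 t O.merged mkP (RL κ Φ t p O (KS.gT mkP gx) (KS.fT mkP fx) + D))).r₀)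
    -- the FACE KIT: constants, exit table rooms, reach, inputs at accuracy `κ.δ₂`
    (hr₀L : (KS0.kit0 t O.merged mkP (((((Mu O.merged)) + 1 : ℕ) : ℤ) * (prFA κ Φ t p O.merged (KS.gT mkP gx κ Φ t p O.merged) (KS.fT mkP fx κ Φ t p O.merged)).D + 1) (KS0.r₀0 t O.merged mkP r)).r₀ + 1 ≤ 2 * (Skelφ.Prm.Lp ((SUS ex mx) κ Φ t p O.merged (KS.gT mkP gx κ Φ t p O.merged) (KS.fT mkP fx κ Φ t p O.merged) q)))
    -- THE PER-CENTRE NUMBERS (x-faces `du.1 = 0`, y′-faces `du.1 = 1`)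
    -- the providers' stride counts within the budget
    -- ONE-SIDED ((R-44)(c)): the numbers' tangential sign is the served sign `1` (one-sided counts `KS.N3WX/N3WY`)
    -- (hp-8 g44) THE NUMBERS BATCH's OWN NODE ROWS: frame rooms at the contact offsets `kEX/kEY` (band `E := Rlev0 + reach0`), the zone bound read by
    -- the two lattice functionals, the one-sided glue rows (x / y′ with `v_L ≥ 0` / y′ with `v_L < 0`), the capacity, the reach budgets, the stride budget
    (hc600 : 600 * Neg.Kq κ ≤ cW)
    (hrX : KS.πBudX κ Φ t p O.merged cW mkP (KS.gT mkP gx κ Φ t p O.merged) (KS.fT mkP fx κ Φ t p O.merged) ≤ r)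
    (hrY : KS.πBudY κ Φ t p O.merged cW mkP (KS.gT mkP gx κ Φ t p O.merged) (KS.fT mkP fx κ Φ t p O.merged) ≤ r)
    (hnB840 : 840 * Neg.Kq κ + 10 ≤ nB)
    -- (hp-8 g44) layer (a4)'s own node row: the bridge core's reach under the kit radius (`|core1Lo|₁ ≤ YbF ≤ r`)
    (hYbr : KS.YbF κ Φ t p O.merged cW mkP (KS.gT mkP gx κ Φ t p O.merged) (KS.fT mkP fx κ Φ t p O.merged) ≤ r)
    -- (hp-8 g44) layer (a5)'s own row: the stride budget under the chain length of record
    (hnBL : nB ≤ Lf κ.K₀)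
    -- (hp-8 g44) layer (a6)'s own NODE ROWS (HypsFW bookkeeping): cap and window rows in the contact slack `A∥ := (hF∥+1)/2 + 5(E−1) + 15`
    (hcapX : 2 * ((((fcellsV κ Φ t p O.merged (KS.gT mkP gx κ Φ t p O.merged) (KS.fT mkP fx κ Φ t p O.merged) (cOf κ Φ t p O (KS.gT mkP gx) (KS.fT mkP fx) cv) (hOf κ Φ t p O (KS.gT mkP gx) (KS.fT mkP fx) hv)).hF 0 : ℤ) + 1) / 2 + (5 * ((((KS0.Rlev0 κ Φ t p O.merged mkP + KS0.reach0 t O.merged mkP) - 1 : ℕ)) : ℤ) + 15)) + 8 * (KS.u₁A κ Φ t p O.merged (KS.gT mkP gx κ Φ t p O.merged) (KS.fT mkP fx κ Φ t p O.merged)) + 8 + 2 * ((fcellsV κ Φ t p O.merged (KS.gT mkP gx κ Φ t p O.merged) (KS.fT mkP fx κ Φ t p O.merged) (cOf κ Φ t p O (KS.gT mkP gx) (KS.fT mkP fx) cv) (hOf κ Φ t p O (KS.gT mkP gx) (KS.fT mkP fx) hv)).c 0 : ℤ) ≤ ((fcellsV κ Φ t p O.merged (KS.gT mkP gx κ Φ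 t p O.merged) (KS.fT mkP fx κ Φ t p O.merged) (cOf κ Φ t p O (KS.gT mkP gx) (KS.fT mkP fx) cv) (hOf κ Φ t p O (KS.gT mkP gx) (KS.fT mkP fx) hv)).r 1 : ℤ))
    (hwinX : 2 * ((((fcellsV κ Φ t p O.merged (KS.gT mkP gx κ Φ t p O.merged) (KS.fT mkP fx κ Φ t p O.merged) (cOf κ Φ t p O (KS.gT mkP gx) (KS.fT mkP fx) cv) (hOf κ Φ t p O (KS.gT mkP gx) (KS.fT mkP fx) hv)).hF 0 : ℤ) + 1) / 2 + (5 * ((((KS0.Rlev0 κ Φ t p O.merged mkP + KS0.reach0 t O.merged mkP) - 1 : ℕ)) : ℤ) + 15)) + ((fcellsV κ Φ t p O.merged (KS.gT mkP gx κ Φ t p O.merged) (KS.fT mkP fx κ Φ t p O.merged) (cOf κ Φ t p O (KS.gT mkP gx) (KS.fT mkP fx) cv) (hOf κ Φ t p O (KS.gT mkP gx) (KS.fT mkP fx) hv)).hF 0 : ℤ) + 6 * (KS.u₁A κ Φ t p O.merged (KS.gT mkP gx κ Φ t p O.merged) (KS.fT mkP fx κ Φ t p O.merged)) ≤ 2 *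 ((fcellsV κ Φ t p O.merged (KS.gT mkP gx κ Φ t p O.merged) (KS.fT mkP fx κ Φ t p O.merged) (cOf κ Φ t p O (KS.gT mkP gx) (KS.fT mkP fx) cv) (hOf κ Φ t p O (KS.gT mkP gx) (KS.fT mkP fx) hv)).c 0 : ℤ) + 2 * ((KS.bwX κ Φ t p O.merged (KS.gT mkP gx κ Φ t p O.merged) (KS.fT mkP fx κ Φ t p O.merged)) : ℤ))
    (hcapY : 2 * ((((fcellsV κ Φ t p O.merged (KS.gT mkP gx κ Φ t p O.merged) (KS.fT mkP fx κ Φ t p O.merged) (cOf κ Φ t p O (KS.gT mkP gx) (KS.fT mkP fx) cv) (hOf κ Φ t p O (KS.gT mkP gx) (KS.fT mkP fx) hv)).hF 1 : ℤ) + 1) / 2 + (5 * ((((KS0.Rlev0 κ Φ t p O.merged mkP + KS0.reach0 t O.merged mkP) - 1 : ℕ)) : ℤ) + 15)) + 24 * (KS.u₀A κ Φ t p O.merged (KS.gT mkP gx κ Φ t p O.merged) (KS.fT mkP fx κ Φ t p O.merged)) + 24 + 2 * ((fcellsV κ Φ t p O.merged (KS.gT mkP gx κ Φ t p O.merged) (KS.fT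 mkP fx κ Φ t p O.merged) (cOf κ Φ t p O (KS.gT mkP gx) (KS.fT mkP fx) cv) (hOf κ Φ t p O (KS.gT mkP gx) (KS.fT mkP fx) hv)).c 1 : ℤ) ≤ ((fcellsV κ Φ t p O.merged (KS.gT mkP gx κ Φ t p O.merged) (KS.fT mkP fx κ Φ t p O.merged) (cOf κ Φ t p O (KS.gT mkP gx) (KS.fT mkP fx) cv) (hOf κ Φ t p O (KS.gT mkP gx) (KS.fT mkP fx) hv)).r 0 : ℤ))
    (hwinY : 2 * ((((fcellsV κ Φ t p O.merged (KS.gT mkP gx κ Φ t p O.merged) (KS.fT mkP fx κ Φ t p O.merged) (cOf κ Φ t p O (KS.gT mkP gx) (KS.fT mkP fx) cv) (hOf κ Φ t p O (KS.gT mkP gx) (KS.fT mkP fx) hv)).hF 1 : ℤ) + 1) / 2 + (5 * ((((KS0.Rlev0 κ Φ t p O.merged mkP + KS0.reach0 t O.merged mkP) - 1 : ℕ)) : ℤ) + 15)) + ((fcellsV κ Φ t p O.merged (KS.gT mkP gx κ Φ t p O.merged) (KS.fT mkP fx κ Φ t p O.merged) (cOf κ Φ t p O (KS.gT mkP gx)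 (KS.fT mkP fx) cv) (hOf κ Φ t p O (KS.gT mkP gx) (KS.fT mkP fx) hv)).hF 1 : ℤ) + 14 * (KS.u₀A κ Φ t p O.merged (KS.gT mkP gx κ Φ t p O.merged) (KS.fT mkP fx κ Φ t p O.merged)) ≤ 2 * ((fcellsV κ Φ t p O.merged (KS.gT mkP gx κ Φ t p O.merged) (KS.fT mkP fx κ Φ t p O.merged) (cOf κ Φ t p O (KS.gT mkP gx) (KS.fT mkP fx) cv) (hOf κ Φ t p O (KS.gT mkP gx) (KS.fT mkP fx) hv)).c 1 : ℤ) + 2 * ((KS.bwY κ Φ t p O.merged (KS.gT mkP gx κ Φ t p O.merged) (KS.fT mkP fx κ Φ t p O.merged)) : ℤ))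
    (hwinYx : 2 * ((((fcellsV κ Φ t p O.merged (KS.gT mkP gx κ Φ t p O.merged) (KS.fT mkP fx κ Φ t p O.merged) (cOf κ Φ t p O (KS.gT mkP gx) (KS.fT mkP fx) cv) (hOf κ Φ t p O (KS.gT mkP gx) (KS.fT mkP fx) hv)).hF 1 : ℤ) + 1) / 2 + (5 * ((((KS0.Rlev0 κ Φ t p O.merged mkP + KS0.reach0 t O.merged mkP) - 1 : ℕ)) : ℤ) + 15)) + ((fcellsV κ Φ t p O.merged (KS.gT mkP gx κ Φ t p O.merged) (KS.fT mkP fx κ Φ t p O.merged) (cOf κ Φ t p O (KS.gT mkP gx) (KS.fT mkP fx) cv) (hOf κ Φ t p O (KS.gT mkP gx) (KS.fT mkP fx) hv)).hF 1 : ℤ) + 24 * (KS.u₀A κ Φ t p O.merged (KS.gT mkP gx κ Φ t p O.merged) (KS.fT mkP fx κ Φ t p O.merged)) + 10 ≤ 2 * ((fcellsV κ Φ t p O.merged (KS.gT mkP gx κ Φ t p O.merged) (KS.fT mkP fx κ Φ t p O.merged) (cOf κ Φ t p O (KS.gT mkP gx) (KS.fT mkP fx) cv) (hOf κ Φ t p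 O (KS.gT mkP gx) (KS.fT mkP fx) hv)).c 1 : ℤ) + 2 * ((KS.bwY κ Φ t p O.merged (KS.gT mkP gx κ Φ t p O.merged) (KS.fT mkP fx κ Φ t p O.merged)) : ℤ)) :
    Skelφ.FaceOblRMOF G ((choiceAtQ3V κ Φ t p Pv (KS.gT mkP gx) (KS.fT mkP fx) (SUS ex mx) cv hv BSlot.small3 hC).scheme O q)
      ((choiceAtQ3V κ Φ t p Pv (KS.gT mkP gx) (KS.fT mkP fx) (SUS ex mx) cv hv BSlot.small3 hC).FD O q) Φ.Δ κ.δ₂ := by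
  have hAt3 := atQ3_of_atQ3V hAt
  have hAtT := atQ3T_of_atQ3 hAt3
  have hNL : EqNumL κ Φ t p O.merged (KS.gT mkP gx κ Φ t p O.merged) (KS.fT mkP fx κ Φ t p O.merged) := eqNumL_of_atQT hAtT
  have hκ10 : (hL κ Φ t p O.merged (KS.gT mkP gx κ Φ t p O.merged) (KS.fT mkP fx κ Φ t p O.merged)).natAbs ≤ 10 * nL κ Φ t p O.merged (KS.gT mkP gx κ Φ t p O.merged) (KS.fT mkP fx κ Φ t p O.merged) := (clauseL_of_atQT hAtT).2
  obtain ⟨hnL1, hℓL1⟩ := one_le_of_eqNumL κ Φ t p O.merged (KS.gT mkP gx κ Φ t p O.merged) (KS.fT mkP fx κ Φ t p O.merged) hNL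
  obtain ⟨hc₀, hc₁⟩ := prFA_c_pos κ Φ t p O.merged (KS.gT mkP gx κ Φ t p O.merged) (KS.fT mkP fx κ Φ t p O.merged)
  have hD : 0 < (prFA κ Φ t p O.merged (KS.gT mkP gx κ Φ t p O.merged) (KS.fT mkP fx κ Φ t p O.merged)).D := prFA_D_pos κ Φ t p O.merged (KS.gT mkP gx κ Φ t p O.merged) (KS.fT mkP fx κ Φ t p O.merged) hNL
  have hDd := prFA_D κ Φ t p O.merged (KS.gT mkP gx κ Φ t p O.merged) (KS.fT mkP fx κ Φ t p O.merged)
  have hn : (prFA κ Φ t p O.merged (KS.gT mkP gx κ Φ t p O.merged) (KS.fT mkP fx κ Φ t p O.merged)).n = (nL κ Φ t p O.merged (KS.gT mkP gx κ Φ t p O.merged) (KS.fT mkP fx κ Φ t p O.merged)) := (prFA_fields κ Φ t p O.merged (KS.gT mkP gx κ Φ t p O.merged) (KS.fT mkP fx κ Φ t p O.merged)).2.1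
  have hM := (prFA κ Φ t p O.merged (KS.gT mkP gx κ Φ t p O.merged) (KS.fT mkP fx κ Φ t p O.merged)).Mabs_pos hc₀ hc₁ hDd hD
  have hE1 : 1 ≤ (KS0.Rlev0 κ Φ t p O.merged mkP + KS0.reach0 t O.merged mkP) := by unfold KS0.reach0; omega
  have hEc : ((((KS0.Rlev0 κ Φ t p O.merged mkP + KS0.reach0 t O.merged mkP) - 1 : ℕ)) : ℤ) = ((KS0.Rlev0 κ Φ t p O.merged mkP + KS0.reach0 t O.merged mkP) : ℤ) - 1 := by omega
  -- the frame rooms at the band (p1-g18's `awF₂V ≥ 0` argument, `FinePrm.hroomF_kFF₂V` at `Rlev := E − 1`)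
  have hnn : ∀ du : MDir, 0 ≤ (prFA κ Φ t p O.merged (KS.gT mkP gx κ Φ t p O.merged) (KS.fT mkP fx κ Φ t p O.merged)).awF₂V (fcellsV κ Φ t p O.merged (KS.gT mkP gx κ Φ t p O.merged) (KS.fT mkP fx κ Φ t p O.merged) (cOf κ Φ t p O (KS.gT mkP gx) (KS.fT mkP fx) cv) (hOf κ Φ t p O (KS.gT mkP gx) (KS.fT mkP fx) hv)) du := fun du => by
    have hfe : ∀ i : Fin 2, 0 ≤ (fcellsV κ Φ t p O.merged (KS.gT mkP gx κ Φ t p O.merged) (KS.fT mkP fx κ Φ t p O.merged) (cOf κ Φ t p O (KS.gT mkP gx) (KS.fT mkP fx) cv) (hOf κ Φ t p O (KS.gT mkP gx) (KS.fT mkP fx) hv)).faceExt du i := fun i => by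
      unfold PCells2V.faceExt; split_ifs
      · exact le_rfl
      · have h3 : (0 : ℤ) ≤ (fcellsV κ Φ t p O.merged (KS.gT mkP gx κ Φ t p O.merged) (KS.fT mkP fx κ Φ t p O.merged) (cOf κ Φ t p O (KS.gT mkP gx) (KS.fT mkP fx) cv) (hOf κ Φ t p O (KS.gT mkP gx) (KS.fT mkP fx) hv)).hB du.1 := Nat.cast_nonneg _; have h4 : (0 : ℤ) ≤ (fcellsV κ Φ t p O.merged (KS.gT mkP gx κ Φ t p O.merged) (KS.fT mkP fx κ Φ t p O.merged) (cOf κ Φ t p O (KS.gT mkP gx) (KS.fT mkP fx) cv) (hOf κ Φ t p O (KS.gT mkP gx) (KS.fT mkP fx) hv)).hF du.1 := Nat.cast_nonneg _; omega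
    have hrd : ∀ I b, 0 ≤ (prFA κ Φ t p O.merged (KS.gT mkP gx κ Φ t p O.merged) (KS.fT mkP fx κ Φ t p O.merged)).rdK I b := fun I b => by
      unfold Skelφ.FinePrm.rdK; exact mul_nonneg ((prFA κ Φ t p O.merged (KS.gT mkP gx κ Φ t p O.merged) (KS.fT mkP fx κ Φ t p O.merged)).cOf_pos hc₀ hc₁ I).le (abs_nonneg _)
    have hnum : 0 ≤ (prFA κ Φ t p O.merged (KS.gT mkP gx κ Φ t p O.merged) (KS.fT mkP fx κ Φ t p O.merged)).awNumV (fcellsV κ Φ t p O.merged (KS.gT mkP gx κ Φ t p O.merged) (KS.fT mkP fx κ Φ t p O.merged) (cOf κ Φ t p O (KS.gT mkP gx) (KS.fT mkP fx) cv) (hOf κ Φ t p O (KS.gT mkP gx) (KS.fT mkP fx) hv)) du := by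
      unfold Skelφ.FinePrm.awNumV
      have := hfe 0; have := hfe 1; have := hrd 1 ((prFA κ Φ t p O.merged (KS.gT mkP gx κ Φ t p O.merged) (KS.fT mkP fx κ Φ t p O.merged)).bOf du.1); have := hrd 0 ((prFA κ Φ t p O.merged (KS.gT mkP gx κ Φ t p O.merged) (KS.fT mkP fx κ Φ t p O.merged)).bOf du.1)
      positivity
    unfold Skelφ.FinePrm.awF₂V
    exact Int.ediv_nonneg (by linarith) hM.le
  have hroomXv :  ∀ du : MDir, du.1 = 0 →
      (prFA κ Φ t p O.merged (KS.gT mkP gx κ Φ t p O.merged) (KS.fT mkP fx κ Φ t p O.merged)).Mabs * ((fun du : MDir => (((prFA κ Φ t p O.merged (KS.gT mkP gx κ Φ t p O.merged) (KS.fT mkP fx κ Φ t p O.merged)).awF₂V (fcellsV κ Φ t p O.merged (KS.gT mkP gx κ Φ t p O.merged) (KS.fT mkP fx κ Φ t p O.merged) (cOf κ Φ t p O (KS.gT mkP gx) (KS.fT mkP fx) cv) (hOf κ Φ t p O (KS.gT mkP gx) (KS.fT mkP fx) hv)) du).toNat)) du + (KS0.Rlev0 κ Φ t p O.merged mkP +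 KS0.reach0 t O.merged mkP)) + (prFA κ Φ t p O.merged (KS.gT mkP gx κ Φ t p O.merged) (KS.fT mkP fx κ Φ t p O.merged)).rdN du.1 ((prFA κ Φ t p O.merged (KS.gT mkP gx κ Φ t p O.merged) (KS.fT mkP fx κ Φ t p O.merged)).bOf du.1) * ((KS0.Rlev0 κ Φ t p O.merged mkP + KS0.reach0 t O.merged mkP) + 1) * (prFA κ Φ t p O.merged (KS.gT mkP gx κ Φ t p O.merged) (KS.fT mkP fx κ Φ t p O.merged)).D ≤ (prFA κ Φ t p O.merged (KS.gT mkP gx κ Φ t p O.merged) (KS.fT mkP fx κ Φ t p O.merged)).rdK du.1 ((prFA κ Φ t p O.merged (KS.gT mkP gx κ Φ t p O.merged) (KS.fT mkP fx κ Φ t p O.merged)).bOf du.1) * ((prFA κ Φ t p O.merged (KS.gT mkP gx κ Φ t p O.merged) (KS.fT mkP fx κ Φ t p O.merged)).kFF₂V (fcellsV κ Φ t p O.merged (KS.gT mkP gx κ Φ t p O.merged) (KS.fT mkP fx κ Φ t p O.merged) (cOf κ Φ t p O (KS.gT mkP gx) (KS.fT mkP fx) cv) (hOf κ Φ t p O (KS.gT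 mkP gx) (KS.fT mkP fx) hv)) ((KS0.Rlev0 κ Φ t p O.merged mkP + KS0.reach0 t O.merged mkP) - 1) 0) * (prFA κ Φ t p O.merged (KS.gT mkP gx κ Φ t p O.merged) (KS.fT mkP fx κ Φ t p O.merged)).D := by
    intro du hI
    have h := (prFA κ Φ t p O.merged (KS.gT mkP gx κ Φ t p O.merged) (KS.fT mkP fx κ Φ t p O.merged)).hroomF_kFF₂V hc₀ hc₁ hDd hD (fcellsV κ Φ t p O.merged (KS.gT mkP gx κ Φ t p O.merged) (KS.fT mkP fx κ Φ t p O.merged) (cOf κ Φ t p O (KS.gT mkP gx) (KS.fT mkP fx) cv) (hOf κ Φ t p O (KS.gT mkP gx) (KS.fT mkP fx) hv)) ((KS0.Rlev0 κ Φ t p O.merged mkP + KS0.reach0 t O.merged mkP) - 1) du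
    have e : (prFA κ Φ t p O.merged (KS.gT mkP gx κ Φ t p O.merged) (KS.fT mkP fx κ Φ t p O.merged)).kFF₂V (fcellsV κ Φ t p O.merged (KS.gT mkP gx κ Φ t p O.merged) (KS.fT mkP fx κ Φ t p O.merged) (cOf κ Φ t p O (KS.gT mkP gx) (KS.fT mkP fx) cv) (hOf κ Φ t p O (KS.gT mkP gx) (KS.fT mkP fx) hv)) ((KS0.Rlev0 κ Φ t p O.merged mkP + KS0.reach0 t O.merged mkP) - 1) du.1 = (prFA κ Φ t p O.merged (KS.gT mkP gx κ Φ t p O.merged) (KS.fT mkP fx κ Φ t p O.merged)).kFF₂V (fcellsV κ Φ t p O.merged (KS.gT mkP gx κ Φ t p O.merged) (KS.fT mkP fx κ Φ t p O.merged) (cOf κ Φ t p O (KS.gT mkP gx) (KS.fT mkP fx) cv) (hOf κ Φ t p O (KS.gT mkP gx) (KS.fT mkP fx) hv)) ((KS0.Rlev0 κ Φ t p O.merged mkP + KS0.reach0 t O.merged mkP) - 1) 0 := by rw [hI]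
    rw [e, hEc] at h
    show (prFA κ Φ t p O.merged (KS.gT mkP gx κ Φ t p O.merged) (KS.fT mkP fx κ Φ t p O.merged)).Mabs * (((((prFA κ Φ t p O.merged (KS.gT mkP gx κ Φ t p O.merged) (KS.fT mkP fx κ Φ t p O.merged)).awF₂V (fcellsV κ Φ t p O.merged (KS.gT mkP gx κ Φ t p O.merged) (KS.fT mkP fx κ Φ t p O.merged) (cOf κ Φ t p O (KS.gT mkP gx) (KS.fT mkP fx) cv) (hOf κ Φ t p O (KS.gT mkP gx) (KS.fT mkP fx) hv)) du).toNat : ℕ) : ℤ) + (((KS0.Rlev0 κ Φ t p O.merged mkP + KS0.reach0 t O.merged mkP) : ℕ) : ℤ)) + _ ≤ _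
    rw [Int.toNat_of_nonneg (hnn du)]
    push_cast
    nlinarith [h]
  have hroomYv :  ∀ du : MDir, du.1 = 1 →
      (prFA κ Φ t p O.merged (KS.gT mkP gx κ Φ t p O.merged) (KS.fT mkP fx κ Φ t p O.merged)).Mabs * ((fun du : MDir => (((prFA κ Φ t p O.merged (KS.gT mkP gx κ Φ t p O.merged) (KS.fT mkP fx κ Φ t p O.merged)).awF₂V (fcellsV κ Φ t p O.merged (KS.gT mkP gx κ Φ t p O.merged) (KS.fT mkP fx κ Φ t p O.merged) (cOf κ Φ t p O (KS.gT mkP gx) (KS.fT mkP fx) cv) (hOf κ Φ t p O (KS.gT mkP gx) (KS.fT mkP fx) hv)) du).toNat)) du + (KS0.Rlev0 κ Φ t p O.merged mkP + KS0.reach0 t O.merged mkP)) + (prFA κ Φ t p O.merged (KS.gT mkP gx κ Φ t p O.merged) (KS.fT mkP fx κ Φ t p O.merged)).rdN du.1 ((prFA κ Φ t p O.merged (KS.gT mkP gx κ Φ t p O.merged) (KS.fT mkP fx κ Φ t p O.merged)).bOf du.1) * ((KS0.Rlev0 κ Φ t p O.merged mkP + KS0.reach0 t O.merged mkP) + 1)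 * (prFA κ Φ t p O.merged (KS.gT mkP gx κ Φ t p O.merged) (KS.fT mkP fx κ Φ t p O.merged)).D ≤ (prFA κ Φ t p O.merged (KS.gT mkP gx κ Φ t p O.merged) (KS.fT mkP fx κ Φ t p O.merged)).rdK du.1 ((prFA κ Φ t p O.merged (KS.gT mkP gx κ Φ t p O.merged) (KS.fT mkP fx κ Φ t p O.merged)).bOf du.1) * ((prFA κ Φ t p O.merged (KS.gT mkP gx κ Φ t p O.merged) (KS.fT mkP fx κ Φ t p O.merged)).kFF₂V (fcellsV κ Φ t p O.merged (KS.gT mkP gx κ Φ t p O.merged) (KS.fT mkP fx κ Φ t p O.merged) (cOf κ Φ t p O (KS.gT mkP gx) (KS.fT mkP fx) cv) (hOf κ Φ t p O (KS.gT mkP gx) (KS.fT mkP fx) hv)) ((KS0.Rlev0 κ Φ t p O.merged mkP + KS0.reach0 t O.merged mkP) - 1) 1) * (prFA κ Φ t p O.merged (KS.gT mkP gx κ Φ t p O.merged) (KS.fT mkP fx κ Φ t p O.merged)).D := by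
    intro du hI
    have h := (prFA κ Φ t p O.merged (KS.gT mkP gx κ Φ t p O.merged) (KS.fT mkP fx κ Φ t p O.merged)).hroomF_kFF₂V hc₀ hc₁ hDd hD (fcellsV κ Φ t p O.merged (KS.gT mkP gx κ Φ t p O.merged) (KS.fT mkP fx κ Φ t p O.merged) (cOf κ Φ t p O (KS.gT mkP gx) (KS.fT mkP fx) cv) (hOf κ Φ t p O (KS.gT mkP gx) (KS.fT mkP fx) hv)) ((KS0.Rlev0 κ Φ t p O.merged mkP + KS0.reach0 t O.merged mkP) - 1) du
    have e : (prFA κ Φ t p O.merged (KS.gT mkP gx κ Φ t p O.merged) (KS.fT mkP fx κ Φ t p O.merged)).kFF₂V (fcellsV κ Φ t p O.merged (KS.gT mkP gx κ Φ t p O.merged) (KS.fT mkP fx κ Φ t p O.merged) (cOf κ Φ t p O (KS.gT mkP gx) (KS.fT mkP fx) cv) (hOf κ Φ t p O (KS.gT mkP gx) (KS.fT mkP fx) hv)) ((KS0.Rlev0 κ Φ t p O.merged mkP + KS0.reach0 t O.merged mkP) - 1) du.1 = (prFA κ Φ t p O.merged (KS.gT mkP gx κ Φ t p O.merged) (KS.fT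 mkP fx κ Φ t p O.merged)).kFF₂V (fcellsV κ Φ t p O.merged (KS.gT mkP gx κ Φ t p O.merged) (KS.fT mkP fx κ Φ t p O.merged) (cOf κ Φ t p O (KS.gT mkP gx) (KS.fT mkP fx) cv) (hOf κ Φ t p O (KS.gT mkP gx) (KS.fT mkP fx) hv)) ((KS0.Rlev0 κ Φ t p O.merged mkP + KS0.reach0 t O.merged mkP) - 1) 1 := by rw [hI]
    rw [e, hEc] at h
    show (prFA κ Φ t p O.merged (KS.gT mkP gx κ Φ t p O.merged) (KS.fT mkP fx κ Φ t p O.merged)).Mabs * (((((prFA κ Φ t p O.merged (KS.gT mkP gx κ Φ t p O.merged) (KS.fT mkP fx κ Φ t p O.merged)).awF₂V (fcellsV κ Φ t p O.merged (KS.gT mkP gx κ Φ t p O.merged) (KS.fT mkP fx κ Φ t p O.merged) (cOf κ Φ t p O (KS.gT mkP gx) (KS.fT mkP fx) cv) (hOf κ Φ t p O (KS.gT mkP gx) (KS.fT mkP fx) hv)) du).toNat : ℕ) : ℤ) + (((KS0.Rlev0 κ Φ t p O.merged mkP + KS0.reach0 t O.merged mkP) : ℕ) : ℤ)) + _ ≤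 _
    rw [Int.toNat_of_nonneg (hnn du)]
    push_cast
    nlinarith [h]
  -- the zone bound at the seed level through the two lattice functionals
  have hkMu := hk_of_atQ hAt3
  have hMuR : Mu O.merged < KS0.R'0 κ Φ t p O.merged mkP := by
    have hKC := (KS0.kit0_ok t O.merged mkP (((Mu O.merged) : ℤ) + 2) (KS0.r₀0 t O.merged mkP 0) (kq := 0) (by norm_num)).2.2.2.1
    have hReach : KS0.reach0 t O.merged mkP < KS0.R'0 κ Φ t p O.merged mkP := (KS0.T0_lt_R'0 κ Φ t p O.merged mkP).2.2.1
    unfold KS0.reach0 at hReach; omega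
  have hMe : (((Mu O.merged) : ℕ) : ℤ) ≤ ((KS.eF κ Φ t p O.merged cW mkP : ℕ) : ℤ) := by
    have : Mu O.merged ≤ KS.eF κ Φ t p O.merged cW mkP := by unfold KS.eF; omega
    exact_mod_cast this
  have hmod0 : 0 < modulus (nL κ Φ t p O.merged (KS.gT mkP gx κ Φ t p O.merged) (KS.fT mkP fx κ Φ t p O.merged)) (hL κ Φ t p O.merged (KS.gT mkP gx κ Φ t p O.merged) (KS.fT mkP fx κ Φ t p O.merged)) (vL κ Φ t p O.merged (KS.gT mkP gx κ Φ t p O.merged) (KS.fT mkP fx κ Φ t p O.merged)) (vβL κ Φ t p O.merged (KS.gT mkP gx κ Φ t p O.merged) (KS.fT mkP fx κ Φ t p O.merged)) := Skelφ.NegPrm.modulus_vβOf_pos hnL1 hℓL1 _ _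
  have hΛZk : (|(prFA κ Φ t p O.merged (KS.gT mkP gx κ Φ t p O.merged) (KS.fT mkP fx κ Φ t p O.merged)).vβ| + |(prFA κ Φ t p O.merged (KS.gT mkP gx κ Φ t p O.merged) (KS.fT mkP fx κ Φ t p O.merged)).vα|) * (((Mu O.merged) : ℕ) : ℤ) ≤ KS.ΛF₀ κ Φ t p O.merged cW mkP (KS.gT mkP gx κ Φ t p O.merged) (KS.fT mkP fx κ Φ t p O.merged) ∧ (((nL κ Φ t p O.merged (KS.gT mkP gx κ Φ t p O.merged) (KS.fT mkP fx κ Φ t p O.merged)) : ℤ) + |(prFA κ Φ t p O.merged (KS.gT mkP gx κ Φ t p O.merged) (KS.fT mkP fx κ Φ t p O.merged)).h|) * (((Mu O.merged) : ℕ) : ℤ) ≤ KS.ΛF₁ κ Φ t p O.merged cW mkP (KS.gT mkP gx κ Φ t p O.merged) (KS.fT mkP fx κ Φ t p O.merged) := by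
    have e1 : (prFA κ Φ t p O.merged (KS.gT mkP gx κ Φ t p O.merged) (KS.fT mkP fx κ Φ t p O.merged)).vβ = vβL κ Φ t p O.merged (KS.gT mkP gx κ Φ t p O.merged) (KS.fT mkP fx κ Φ t p O.merged) := rfl
    have e2 : (prFA κ Φ t p O.merged (KS.gT mkP gx κ Φ t p O.merged) (KS.fT mkP fx κ Φ t p O.merged)).vα = vL κ Φ t p O.merged (KS.gT mkP gx κ Φ t p O.merged) (KS.fT mkP fx κ Φ t p O.merged) := rfl
    have e3 : (prFA κ Φ t p O.merged (KS.gT mkP gx κ Φ t p O.merged) (KS.fT mkP fx κ Φ t p O.merged)).h = hL κ Φ t p O.merged (KS.gT mkP gx κ Φ t p O.merged) (KS.fT mkP fx κ Φ t p O.merged) := rfl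
    rw [e1, e2, e3]
    have hb := abs_nonneg (vβL κ Φ t p O.merged (KS.gT mkP gx κ Φ t p O.merged) (KS.fT mkP fx κ Φ t p O.merged)); have ha := abs_nonneg (vL κ Φ t p O.merged (KS.gT mkP gx κ Φ t p O.merged) (KS.fT mkP fx κ Φ t p O.merged)); have hh := abs_nonneg (hL κ Φ t p O.merged (KS.gT mkP gx κ Φ t p O.merged) (KS.fT mkP fx κ Φ t p O.merged))
    have hnl : (0 : ℤ) ≤ ((nL κ Φ t p O.merged (KS.gT mkP gx κ Φ t p O.merged) (KS.fT mkP fx κ Φ t p O.merged)) : ℤ) := by positivity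
    have hl : (0 : ℤ) ≤ ((ℓL κ Φ t p O.merged (KS.gT mkP gx κ Φ t p O.merged) (KS.fT mkP fx κ Φ t p O.merged)) : ℤ) := by positivity
    constructor
    · unfold KS.ΛF₀
      nlinarith [mul_le_mul_of_nonneg_left hMe hb, mul_le_mul_of_nonneg_left hMe ha, hmod0.le, mul_nonneg hnl hl, mul_nonneg ha hl]
    · unfold KS.ΛF₁
      nlinarith [mul_le_mul_of_nonneg_left hMe (add_nonneg hnl hh), mul_nonneg hnl hl]
  obtain ⟨-, -, -, -, hΛeq⟩ := Skelφ.StepI.OutO.FactsO.seed hAt3.1.factsO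
  have hZU : ∀ c, (↑(O.merged.Λ c (Mu O.merged)) : Set V) ⊆ Skelφ.cyl (φL κ Φ t p O.D O.DT.toDataN O.ori (KS.gT mkP gx κ Φ t p O.merged) (KS.fT mkP fx κ Φ t p O.merged)) c (Mu O.merged) := fun c => by
    have e : O.merged.Λ c (Mu O.merged) = Skelφ.fatSeq Φ.frame hC c (Mu O.merged) := by
      have := congrFun (congrFun hΛeq c) (Mu O.merged); exact this
    unfold φL; rw [Skelφ.cyl_oriφ, e]; exact Skelφ.fatSeq_subset_cyl Φ.frame hC c _
  -- UNDER PROXIES the zone family is `Λ ∘ prox` at the seed level; the proxy has the SAME chart image (`HasProxies.oriφ_prox`), so the cylinder about `prox c` IS the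
  -- cylinder about `c` and the lattice-functional bound below is the U bound verbatim
  have hZ : ∀ c, (↑(O.merged.Λ (hP.prox c) (Mu O.merged)) : Set V) ⊆ Skelφ.cyl (φL κ Φ t p O.D O.DT.toDataN O.ori (KS.gT mkP gx κ Φ t p O.merged) (KS.fT mkP fx κ Φ t p O.merged)) c (Mu O.merged) := fun c => by
    have e : Skelφ.cyl (φL κ Φ t p O.D O.DT.toDataN O.ori (KS.gT mkP gx κ Φ t p O.merged) (KS.fT mkP fx κ Φ t p O.merged)) c (Mu O.merged) =
        Skelφ.cyl (φL κ Φ t p O.D O.DT.toDataN O.ori (KS.gT mkP gx κ Φ t p O.merged) (KS.fT mkP fx κ Φ t p O.merged)) (hP.prox c) (Mu O.merged) :=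
      (Skelφ.cyl_eq_of_apply_eq (hP.oriφ_prox _ c) _).symm
    rw [e]; exact hZU (hP.prox c)
  have hZb : ∀ c', ∀ v ∈ O.merged.Λ (hP.prox c') (Mu O.merged), (φL κ Φ t p O.D O.DT.toDataN O.ori (KS.gT mkP gx κ Φ t p O.merged) (KS.fT mkP fx κ Φ t p O.merged)) v - (φL κ Φ t p O.D O.DT.toDataN O.ori (KS.gT mkP gx κ Φ t p O.merged) (KS.fT mkP fx κ Φ t p O.merged)) c' ∈ box 2 (Mu O.merged) := fun c' v hv =>
    (Skelφ.mem_cyl (φL κ Φ t p O.D O.DT.toDataN O.ori (KS.gT mkP gx κ Φ t p O.merged) (KS.fT mkP fx κ Φ t p O.merged)) c' (Mu O.merged) v).1 (hZ c' (Finset.mem_coe.2 hv))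
  have hZkv :  ∀ (c' : V) (du : MDir), ∀ v ∈ O.merged.Λ (hP.prox c') (Mu O.merged), |(prFA κ Φ t p O.merged (KS.gT mkP gx κ Φ t p O.merged) (KS.fT mkP fx κ Φ t p O.merged)).ψ (φL κ Φ t p O.D O.DT.toDataN O.ori (KS.gT mkP gx κ Φ t p O.merged) (KS.fT mkP fx κ Φ t p O.merged)) c' v du.1| ≤ (fun i : Fin 2 => if i = 0 then KS.kF₀A κ Φ t p O.merged cW mkP (KS.gT mkP gx κ Φ t p O.merged) (KS.fT mkP fx κ Φ t p O.merged) else KS.kF₁A κ Φ t p O.merged cW mkP (KS.gT mkP gx κ Φ t p O.merged) (KS.fT mkP fx κ Φ t p O.merged)) du.1 :=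
    Skelφ.zone_fine_le_of_lam (φ := (φL κ Φ t p O.D O.DT.toDataN O.ori (KS.gT mkP gx κ Φ t p O.merged) (KS.fT mkP fx κ Φ t p O.merged))) (kA := (fun i : Fin 2 => if i = 0 then KS.kF₀A κ Φ t p O.merged cW mkP (KS.gT mkP gx κ Φ t p O.merged) (KS.fT mkP fx κ Φ t p O.merged) else KS.kF₁A κ Φ t p O.merged cW mkP (KS.gT mkP gx κ Φ t p O.merged) (KS.fT mkP fx κ Φ t p O.merged))) (prFA κ Φ t p O.merged (KS.gT mkP gx κ Φ t p O.merged) (KS.fT mkP fx κ Φ t p O.merged)) hn hD hc₀.le hc₁.le hΛZk (KS.hkF0_RA κ Φ t p O.merged cW mkP (KS.gT mkP gx κ Φ t p O.merged) (KS.fT mkP fx κ Φ t p O.merged) hNL) (KS.hkF1_RA κ Φ t p O.merged cW mkP (KS.gT mkP gx κ Φ t p O.merged) (KS.fT mkP fx κ Φ t p O.merged) hNL)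
      (fun c' => O.merged.Λ (hP.prox c') (Mu O.merged)) hZb
  -- the band rows (HypsFW bookkeeping at the contact offsets kEX/kEY)
  have hB0 : ((fcellsV κ Φ t p O.merged (KS.gT mkP gx κ Φ t p O.merged) (KS.fT mkP fx κ Φ t p O.merged) (cOf κ Φ t p O (KS.gT mkP gx) (KS.fT mkP fx) cv) (hOf κ Φ t p O (KS.gT mkP gx) (KS.fT mkP fx) hv)).hB 0 : ℤ) = 2 * ((fcellsV κ Φ t p O.merged (KS.gT mkP gx κ Φ t p O.merged) (KS.fT mkP fx κ Φ t p O.merged) (cOf κ Φ t p O (KS.gT mkP gx) (KS.fT mkP fx) cv) (hOf κ Φ t p O (KS.gT mkP gx) (KS.fT mkP fx) hv)).r 1 : ℤ) := by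
    rw [fcellsV_hB, fcellsV_r]; push_cast; rfl
  have hB1 : ((fcellsV κ Φ t p O.merged (KS.gT mkP gx κ Φ t p O.merged) (KS.fT mkP fx κ Φ t p O.merged) (cOf κ Φ t p O (KS.gT mkP gx) (KS.fT mkP fx) cv) (hOf κ Φ t p O (KS.gT mkP gx) (KS.fT mkP fx) hv)).hB 1 : ℤ) = 2 * ((fcellsV κ Φ t p O.merged (KS.gT mkP gx κ Φ t p O.merged) (KS.fT mkP fx κ Φ t p O.merged) (cOf κ Φ t p O (KS.gT mkP gx) (KS.fT mkP fx) cv) (hOf κ Φ t p O (KS.gT mkP gx) (KS.fT mkP fx) hv)).r 0 : ℤ) := by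
    rw [fcellsV_hB, fcellsV_r]; push_cast; rfl
  have hu0 : (0 : ℤ) ≤ (KS.u₀A κ Φ t p O.merged (KS.gT mkP gx κ Φ t p O.merged) (KS.fT mkP fx κ Φ t p O.merged)) := by unfold KS.u₀A; positivity
  have hu1 : (0 : ℤ) ≤ (KS.u₁A κ Φ t p O.merged (KS.gT mkP gx κ Φ t p O.merged) (KS.fT mkP fx κ Φ t p O.merged)) := by unfold KS.u₁A; positivity
  have hkX : ((prFA κ Φ t p O.merged (KS.gT mkP gx κ Φ t p O.merged) (KS.fT mkP fx κ Φ t p O.merged)).kFF₂V (fcellsV κ Φ t p O.merged (KS.gT mkP gx κ Φ t p O.merged) (KS.fT mkP fx κ Φ t p O.merged) (cOf κ Φ t p O (KS.gT mkP gx) (KS.fT mkP fx) cv) (hOf κ Φ t p O (KS.gT mkP gx) (KS.fT mkP fx) hv)) ((KS0.Rlev0 κ Φ t p O.merged mkP + KS0.reach0 t O.merged mkP) - 1) 0) ≤ (((fcellsV κ Φ t p O.merged (KS.gT mkP gx κ Φ t p O.merged) (KS.fT mkP fx κ Φ t p O.merged) (cOf κ Φ t p O (KS.gT mkP gx) (KS.fT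 mkP fx) cv) (hOf κ Φ t p O (KS.gT mkP gx) (KS.fT mkP fx) hv)).hB 0 : ℤ) + (fcellsV κ Φ t p O.merged (KS.gT mkP gx κ Φ t p O.merged) (KS.fT mkP fx κ Φ t p O.merged) (cOf κ Φ t p O (KS.gT mkP gx) (KS.fT mkP fx) cv) (hOf κ Φ t p O (KS.gT mkP gx) (KS.fT mkP fx) hv)).hF 0 + 1) / 2 + (5 * ((((KS0.Rlev0 κ Φ t p O.merged mkP + KS0.reach0 t O.merged mkP) - 1 : ℕ)) : ℤ) + 15) := by
    have h := kFF₂V_le_lin κ Φ t p O.merged (KS.fT mkP fx κ Φ t p O.merged) mkP gx hNL hκ10 (fcellsV κ Φ t p O.merged (KS.gT mkP gx κ Φ t p O.merged) (KS.fT mkP fx κ Φ t p O.merged) (cOf κ Φ t p O (KS.gT mkP gx) (KS.fT mkP fx) cv) (hOf κ Φ t p O (KS.gT mkP gx) (KS.fT mkP fx) hv)) ((KS0.Rlev0 κ Φ t p O.merged mkP + KS0.reach0 t O.merged mkP) - 1) 0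
    rw [(faceExtV_apply (fcellsV κ Φ t p O.merged (KS.gT mkP gx κ Φ t p O.merged) (KS.fT mkP fx κ Φ t p O.merged) (cOf κ Φ t p O (KS.gT mkP gx) (KS.fT mkP fx) cv) (hOf κ Φ t p O (KS.gT mkP gx) (KS.fT mkP fx) hv)) 0).2] at h; linarith
  have hkY : ((prFA κ Φ t p O.merged (KS.gT mkP gx κ Φ t p O.merged) (KS.fT mkP fx κ Φ t p O.merged)).kFF₂V (fcellsV κ Φ t p O.merged (KS.gT mkP gx κ Φ t p O.merged) (KS.fT mkP fx κ Φ t p O.merged) (cOf κ Φ t p O (KS.gT mkP gx) (KS.fT mkP fx) cv) (hOf κ Φ t p O (KS.gT mkP gx) (KS.fT mkP fx) hv)) ((KS0.Rlev0 κ Φ t p O.merged mkP + KS0.reach0 t O.merged mkP) - 1) 1) ≤ (((fcellsV κ Φ t p O.merged (KS.gT mkP gx κ Φ t p O.merged) (KS.fT mkP fx κ Φ t p O.merged) (cOf κ Φ t p O (KS.gT mkP gx) (KS.fT mkP fx) cv) (hOf κ Φ t p O (KS.gT mkP gx) (KS.fT mkP fx) hv)).hB 1 : ℤ) + (fcellsV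 κ Φ t p O.merged (KS.gT mkP gx κ Φ t p O.merged) (KS.fT mkP fx κ Φ t p O.merged) (cOf κ Φ t p O (KS.gT mkP gx) (KS.fT mkP fx) cv) (hOf κ Φ t p O (KS.gT mkP gx) (KS.fT mkP fx) hv)).hF 1 + 1) / 2 + (5 * ((((KS0.Rlev0 κ Φ t p O.merged mkP + KS0.reach0 t O.merged mkP) - 1 : ℕ)) : ℤ) + 15) := by
    have h := kFF₂V_le_lin κ Φ t p O.merged (KS.fT mkP fx κ Φ t p O.merged) mkP gx hNL hκ10 (fcellsV κ Φ t p O.merged (KS.gT mkP gx κ Φ t p O.merged) (KS.fT mkP fx κ Φ t p O.merged) (cOf κ Φ t p O (KS.gT mkP gx) (KS.fT mkP fx) cv) (hOf κ Φ t p O (KS.gT mkP gx) (KS.fT mkP fx) hv)) ((KS0.Rlev0 κ Φ t p O.merged mkP + KS0.reach0 t O.merged mkP) - 1) 1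
    rw [(faceExtV_apply (fcellsV κ Φ t p O.merged (KS.gT mkP gx κ Φ t p O.merged) (KS.fT mkP fx κ Φ t p O.merged) (cOf κ Φ t p O (KS.gT mkP gx) (KS.fT mkP fx) cv) (hOf κ Φ t p O (KS.gT mkP gx) (KS.fT mkP fx) hv)) 1).2] at h; linarith
  have hkEVX : ((prFA κ Φ t p O.merged (KS.gT mkP gx κ Φ t p O.merged) (KS.fT mkP fx κ Φ t p O.merged)).kFF₂V (fcellsV κ Φ t p O.merged (KS.gT mkP gx κ Φ t p O.merged) (KS.fT mkP fx κ Φ t p O.merged) (cOf κ Φ t p O (KS.gT mkP gx) (KS.fT mkP fx) cv) (hOf κ Φ t p O (KS.gT mkP gx) (KS.fT mkP fx) hv)) ((KS0.Rlev0 κ Φ t p O.merged mkP + KS0.reach0 t O.merged mkP) - 1) 0) ≤ ((fcellsV κ Φ t p O.merged (KS.gT mkP gx κ Φ t p O.merged) (KS.fT mkP fx κ Φ t p O.merged) (cOf κ Φ t p O (KS.gT mkP gx) (KS.fT mkP fx) cv) (hOf κ Φ t p O (KS.gT mkP gx) (KS.fT mkP fx) hv)).r 1 : ℤ) + ((((fcellsV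 κ Φ t p O.merged (KS.gT mkP gx κ Φ t p O.merged) (KS.fT mkP fx κ Φ t p O.merged) (cOf κ Φ t p O (KS.gT mkP gx) (KS.fT mkP fx) cv) (hOf κ Φ t p O (KS.gT mkP gx) (KS.fT mkP fx) hv)).hF 0 : ℤ) + 1) / 2 + (5 * ((((KS0.Rlev0 κ Φ t p O.merged mkP + KS0.reach0 t O.merged mkP) - 1 : ℕ)) : ℤ) + 15)) := by
    have h := (fcellsV κ Φ t p O.merged (KS.gT mkP gx κ Φ t p O.merged) (KS.fT mkP fx κ Φ t p O.merged) (cOf κ Φ t p O (KS.gT mkP gx) (KS.fT mkP fx) cv) (hOf κ Φ t p O (KS.gT mkP gx) (KS.fT mkP fx) hv)).contact_rowW 0 hB0 hkX; exact h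
  have hkEVY : ((prFA κ Φ t p O.merged (KS.gT mkP gx κ Φ t p O.merged) (KS.fT mkP fx κ Φ t p O.merged)).kFF₂V (fcellsV κ Φ t p O.merged (KS.gT mkP gx κ Φ t p O.merged) (KS.fT mkP fx κ Φ t p O.merged) (cOf κ Φ t p O (KS.gT mkP gx) (KS.fT mkP fx) cv) (hOf κ Φ t p O (KS.gT mkP gx) (KS.fT mkP fx) hv)) ((KS0.Rlev0 κ Φ t p O.merged mkP + KS0.reach0 t O.merged mkP) - 1) 1) ≤ ((fcellsV κ Φ t p O.merged (KS.gT mkP gx κ Φ t p O.merged) (KS.fT mkP fx κ Φ t p O.merged) (cOf κ Φ t p O (KS.gT mkP gx) (KS.fT mkP fx) cv) (hOf κ Φ t p O (KS.gT mkP gx) (KS.fT mkP fx) hv)).r 0 : ℤ) + ((((fcellsV κ Φ t p O.merged (KS.gT mkP gx κ Φ t p O.merged) (KS.fT mkP fx κ Φ t p O.merged) (cOf κ Φ t p O (KS.gT mkP gx) (KS.fT mkP fx) cv) (hOf κ Φ t p O (KS.gT mkP gx) (KS.fT mkP fx) hv)).hF 1 : ℤ) + 1) / 2 + (5 * ((((KS0.Rlev0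 κ Φ t p O.merged mkP + KS0.reach0 t O.merged mkP) - 1 : ℕ)) : ℤ) + 15)) := by
    have h := (fcellsV κ Φ t p O.merged (KS.gT mkP gx κ Φ t p O.merged) (KS.fT mkP fx κ Φ t p O.merged) (cOf κ Φ t p O (KS.gT mkP gx) (KS.fT mkP fx) cv) (hOf κ Φ t p O (KS.gT mkP gx) (KS.fT mkP fx) hv)).contact_rowW 1 hB1 hkY; exact h
  have hBX := (fcellsV κ Φ t p O.merged (KS.gT mkP gx κ Φ t p O.merged) (KS.fT mkP fx κ Φ t p O.merged) (cOf κ Φ t p O (KS.gT mkP gx) (KS.fT mkP fx) cv) (hOf κ Φ t p O (KS.gT mkP gx) (KS.fT mkP fx) hv)).bandX_hypsW hB0 hu1 hkEVX hcapX hwinX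
  have hBY := (fcellsV κ Φ t p O.merged (KS.gT mkP gx κ Φ t p O.merged) (KS.fT mkP fx κ Φ t p O.merged) (cOf κ Φ t p O (KS.gT mkP gx) (KS.fT mkP fx) cv) (hOf κ Φ t p O (KS.gT mkP gx) (KS.fT mkP fx) hv)).bandY_hypsW hB1 hu0 hkEVY hcapY hwinY
  have hfwdYxv : 2 * ((prFA κ Φ t p O.merged (KS.gT mkP gx κ Φ t p O.merged) (KS.fT mkP fx κ Φ t p O.merged)).kFF₂V (fcellsV κ Φ t p O.merged (KS.gT mkP gx κ Φ t p O.merged) (KS.fT mkP fx κ Φ t p O.merged) (cOf κ Φ t p O (KS.gT mkP gx) (KS.fT mkP fx) cv) (hOf κ Φ t p O (KS.gT mkP gx) (KS.fT mkP fx) hv)) ((KS0.Rlev0 κ Φ t p O.merged mkP + KS0.reach0 t O.merged mkP) - 1) 1) + ((fcellsV κ Φ t p O.merged (KS.gT mkP gx κ Φ t p O.merged) (KS.fT mkP fx κ Φ t p O.merged) (cOf κ Φ t p O (KS.gT mkP gx) (KS.fT mkP fx) cv) (hOf κ Φ t p O (KS.gT mkP gx) (KS.fT mkP fx) hv)).hF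 1 : ℤ) - (fcellsV κ Φ t p O.merged (KS.gT mkP gx κ Φ t p O.merged) (KS.fT mkP fx κ Φ t p O.merged) (cOf κ Φ t p O (KS.gT mkP gx) (KS.fT mkP fx) cv) (hOf κ Φ t p O (KS.gT mkP gx) (KS.fT mkP fx) hv)).hB 1 + 24 * (KS.u₀A κ Φ t p O.merged (KS.gT mkP gx κ Φ t p O.merged) (KS.fT mkP fx κ Φ t p O.merged)) + 10 ≤ 2 * (((fcellsV κ Φ t p O.merged (KS.gT mkP gx κ Φ t p O.merged) (KS.fT mkP fx κ Φ t p O.merged) (cOf κ Φ t p O (KS.gT mkP gx) (KS.fT mkP fx) cv) (hOf κ Φ t p O (KS.gT mkP gx) (KS.fT mkP fx) hv)).c 1 : ℤ) + ((KS.bwY κ Φ t p O.merged (KS.gT mkP gx κ Φ t p O.merged) (KS.fT mkP fx κ Φ t p O.merged)) : ℤ)) := by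
    rw [hB1]; linarith
  exact faceOblRM_frmBVC₅Px (kEX := ((prFA κ Φ t p O.merged (KS.gT mkP gx κ Φ t p O.merged) (KS.fT mkP fx κ Φ t p O.merged)).kFF₂V (fcellsV κ Φ t p O.merged (KS.gT mkP gx κ Φ t p O.merged) (KS.fT mkP fx κ Φ t p O.merged) (cOf κ Φ t p O (KS.gT mkP gx) (KS.fT mkP fx) cv) (hOf κ Φ t p O (KS.gT mkP gx) (KS.fT mkP fx) hv)) ((KS0.Rlev0 κ Φ t p O.merged mkP + KS0.reach0 t O.merged mkP) - 1) 0)) (kEY := ((prFA κ Φ t p O.merged (KS.gT mkP gx κ Φ t p O.merged) (KS.fT mkP fx κ Φ t p O.merged)).kFF₂V (fcellsV κ Φ t p O.merged (KS.gT mkP gx κ Φ t p O.merged) (KS.fT mkP fx κ Φ t p O.merged) (cOf κ Φ t p O (KS.gT mkP gx) (KS.fT mkP fx) cv) (hOf κ Φ t p O (KS.gT mkP gx) (KS.fT mkP fx) hv)) ((KS0.Rlev0 κ Φ t p O.merged mkP + KS0.reach0 t O.merged mkP) - 1) 1)) mk mkP cW gx fx hgx hfx ex mx hmx hAt hP hDk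 hnK hDnL hnBF hRK hp0 hp1 hMR0 hPx Lf hCF hL' hRlr nB hRb₀ hr₁R hRr₀ hr₂R hRsr hρr hR₁b hR₁r hr₀L hroomXv hroomYv hZkv hBX.1 hBX.2.1 hBX.2.2 hBY.1 hBY.2.1 hBY.2.2.1 hBY.2.2.2 hfwdYxv hc600 hrX hrY hnB840 hYbr hnBL

/-! ## §2 Layer (a7) under proxies: the pointwise (F) obligation from slot floors -/

set_option maxHeartbeats 3200000 in
/-- **Layer (a7) of the (F) wrapper UNDER PROXIES: the slot rows discharged at `r := L′(SUS ex mx)`, `nB := Lf K₀`** — GEN twin of «SkelFrmFromBFaceHoldsQ3VOf»'s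
private `faceOblRM_frmBVC₇'` in the (F) PORT SHAPE OF RECORD: the POINTWISE (F) obligation at `(O, q)` for plain slots at the raised kit index `mkP`, from the
residual floors `gxFc mkP cW ≤ gx`, `fxFc mkP ≤ fx`, `exF2 mkP cW ≤ ex` (U's ∀-record forms at the fixed index `mkP`), the block ceiling `hmx`, the face-bridge pair in the pair slot,
the five node rows, and UNDER PROXIES the floors `hnL/hnK/hDk/hnBF` + the K-2 link `hRK`.  The (F) TOP («SkelFrmFrom1FaceHoldsQ3VNodePx», gen-1 g2) applies it at
`mk := 0`, `mkP := KS.RK t O.merged 0 + D`, `gx/fx :=` the Q-slots at `mkP` and the fibre block swapped to the fixed-index `SUS (exQ mkP (exRD mkP D)) (mxQ (mxF mkP))`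
(design-owner ruling 2026-08-27T00:45Z: SlotCongrPx + the top's S-bridges).  What is NOT U-verbatim in the proof: the `+ D` radii (`RL + D`, `R_bF + D`) and the rim radius `D + fatRadius k` are absorbed WITHOUT a new slot floor — `r₀0 (X + D) ≤ r₀0 X + D`, `D ≤ k ≤
fatRadius k = ψπ` and `L′(SUS) = ex + Rex(2ψπ) + 24·rmax′ + 3ψπ + 48`. [cite: KozmaNitzan2024, §4 Lemma 12 (pp. 23–25)] -/
theorem faceOblRM_frmBVC₇Px {κ : Consts} {V : Type} [DecidableEq V] [Countable V] {G : SimpleGraph V} [G.LocallyFinite] {Φ : PlanarSkeletonFrmFrom G} {t : V} {p : unitInterval} {Pv : NegB.PSlot} {cv : NegB.CSlot} {hv : NegB.CSlot} {hC : Φ.CylSubcritical p} {O : OutNS V} {q : unitInterval}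
    (mk mkP cW : ℕ)
    (gx fx : Neg.FSlot)
    (hgx : ∀ D : DataNS V, gxFc mkP cW κ Φ t p D ≤ gx κ Φ t p D)
    (hfx : ∀ D : DataNS V, fxFc mkP κ Φ t p D ≤ fx κ Φ t p D)
    (ex mx : GSlot)
    (hex : ∀ (D : DataNS V) (g f : ℕ), exF2 mkP cW κ Φ t p D g f ≤ ex κ Φ t p D g f)
    (hmx : (prFA κ Φ t p O.merged (KS.gT mkP gx κ Φ t p O.merged) (KS.fT mkP fx κ Φ t p O.merged)).mF (fcellsA κ Φ t p O.merged (KS.gT mkP gx κ Φ t p O.merged) (KS.fT mkP fx κ Φ t p O.merged)) ≤ (((mx κ Φ t p O.merged (KS.gT mkP gx κ Φ t p O.merged) (KS.fT mkP fx κ Φ t p O.merged)) : ℕ) : ℤ))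
    (hAt : (choiceAtQ3V κ Φ t p Pv (KS.gT mkP gx) (KS.fT mkP fx) (SUS ex mx) cv hv BSlot.small3 hC).AtQNQ O q)
    {D : ℕ} (hP : Φ.HasProxies t D)
    -- UNDER PROXIES: the width floors (C-4) and the RAISED KIT INDEX `mkP` (K-2: same record, `RK mk + D ≤ RK mkP`; the served region / zone prism stays at `mk`)
    (hDk : D ≤ O.merged.k) (hnK : D ≤ KS.nKit O.merged mk) (hDnL : D ≤ (nL κ Φ t p O.merged (KS.gT mkP gx κ Φ t p O.merged) (KS.fT mkP fx κ Φ t p O.merged)))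
    (hnBF : D ≤ KS.nBF κ Φ t p O.merged cW mkP)
    (hRK : KS.RK t O.merged mk + D ≤ KS.RK t O.merged mkP)
    (hp0 : 0 < (p : ℝ))
    (hp1 : (p : ℝ) < 1)
    (hPx : ((KS.MBF κ Φ t p O.merged cW mkP), (KS.nBF κ Φ t p O.merged cW mkP)) ∈ (Pv κ Φ t p O.merged).1)
    (Lf : ℕ → ℕ)
    (hCF : ChainFactQT Lf G Φ.Δ κ (κ.δ₂ ^ 3))
    (hLf : 840 * Neg.Kq κ + 10 ≤ Lf κ.K₀)
    -- the two lattice functionals, the one-sided glue rows (x / y′ with `v_L ≥ 0` / y′ with `v_L < 0`), the capacity, the reach budgets, the stride budget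
    (hc600 : 600 * Neg.Kq κ ≤ cW)
    -- (hp-8 g44) layer (a6)'s own NODE ROWS (HypsFW bookkeeping): cap and window rows in the contact slack `A∥ := (hF∥+1)/2 + 5(E−1) + 15`
    (hcapX : 2 * ((((fcellsV κ Φ t p O.merged (KS.gT mkP gx κ Φ t p O.merged) (KS.fT mkP fx κ Φ t p O.merged) (cOf κ Φ t p O (KS.gT mkP gx) (KS.fT mkP fx) cv) (hOf κ Φ t p O (KS.gT mkP gx) (KS.fT mkP fx) hv)).hF 0 : ℤ) + 1) / 2 + (5 * ((((KS0.Rlev0 κ Φ t p O.merged mkP + KS0.reach0 t O.merged mkP) - 1 : ℕ)) : ℤ) + 15)) + 8 * (KS.u₁A κ Φ t p O.merged (KS.gT mkP gx κ Φ t p O.merged) (KS.fT mkP fx κ Φ t p O.merged)) + 8 + 2 * ((fcellsV κ Φ t p O.merged (KS.gT mkP gx κ Φ t p O.merged) (KS.fT mkP fx κ Φ t p O.merged) (cOf κ Φ t p O (KS.gT mkP gx) (KS.fT mkP fx) cv) (hOf κ Φ t p O (KS.gT mkP gx) (KS.fT mkP fx) hv)).c 0 : ℤ) ≤ ((fcellsV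 κ Φ t p O.merged (KS.gT mkP gx κ Φ t p O.merged) (KS.fT mkP fx κ Φ t p O.merged) (cOf κ Φ t p O (KS.gT mkP gx) (KS.fT mkP fx) cv) (hOf κ Φ t p O (KS.gT mkP gx) (KS.fT mkP fx) hv)).r 1 : ℤ))
    (hwinX : 2 * ((((fcellsV κ Φ t p O.merged (KS.gT mkP gx κ Φ t p O.merged) (KS.fT mkP fx κ Φ t p O.merged) (cOf κ Φ t p O (KS.gT mkP gx) (KS.fT mkP fx) cv) (hOf κ Φ t p O (KS.gT mkP gx) (KS.fT mkP fx) hv)).hF 0 : ℤ) + 1) / 2 + (5 * ((((KS0.Rlev0 κ Φ t p O.merged mkP + KS0.reach0 t O.merged mkP) - 1 : ℕ)) : ℤ) + 15)) + ((fcellsV κ Φ t p O.merged (KS.gT mkP gx κ Φ t p O.merged) (KS.fT mkP fx κ Φ t p O.merged) (cOf κ Φ t p O (KS.gT mkP gx) (KS.fT mkP fx) cv) (hOf κ Φ t p O (KS.gT mkP gx) (KS.fT mkP fx) hv)).hF 0 : ℤ) + 6 * (KS.u₁A κ Φ t p O.merged (KS.gT mkP gx κ Φ t p O.merged) (KS.fT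 mkP fx κ Φ t p O.merged)) ≤ 2 * ((fcellsV κ Φ t p O.merged (KS.gT mkP gx κ Φ t p O.merged) (KS.fT mkP fx κ Φ t p O.merged) (cOf κ Φ t p O (KS.gT mkP gx) (KS.fT mkP fx) cv) (hOf κ Φ t p O (KS.gT mkP gx) (KS.fT mkP fx) hv)).c 0 : ℤ) + 2 * ((KS.bwX κ Φ t p O.merged (KS.gT mkP gx κ Φ t p O.merged) (KS.fT mkP fx κ Φ t p O.merged)) : ℤ))
    (hcapY : 2 * ((((fcellsV κ Φ t p O.merged (KS.gT mkP gx κ Φ t p O.merged) (KS.fT mkP fx κ Φ t p O.merged) (cOf κ Φ t p O (KS.gT mkP gx) (KS.fT mkP fx) cv) (hOf κ Φ t p O (KS.gT mkP gx) (KS.fT mkP fx) hv)).hF 1 : ℤ) + 1) / 2 + (5 * ((((KS0.Rlev0 κ Φ t p O.merged mkP + KS0.reach0 t O.merged mkP) - 1 : ℕ)) : ℤ) + 15)) + 24 * (KS.u₀A κ Φ t p O.merged (KS.gT mkP gx κ Φ t p O.merged) (KS.fT mkP fx κ Φ t p O.merged)) + 24 + 2 * ((fcellsV κ Φ t p O.merged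 (KS.gT mkP gx κ Φ t p O.merged) (KS.fT mkP fx κ Φ t p O.merged) (cOf κ Φ t p O (KS.gT mkP gx) (KS.fT mkP fx) cv) (hOf κ Φ t p O (KS.gT mkP gx) (KS.fT mkP fx) hv)).c 1 : ℤ) ≤ ((fcellsV κ Φ t p O.merged (KS.gT mkP gx κ Φ t p O.merged) (KS.fT mkP fx κ Φ t p O.merged) (cOf κ Φ t p O (KS.gT mkP gx) (KS.fT mkP fx) cv) (hOf κ Φ t p O (KS.gT mkP gx) (KS.fT mkP fx) hv)).r 0 : ℤ))
    (hwinY : 2 * ((((fcellsV κ Φ t p O.merged (KS.gT mkP gx κ Φ t p O.merged) (KS.fT mkP fx κ Φ t p O.merged) (cOf κ Φ t p O (KS.gT mkP gx) (KS.fT mkP fx) cv) (hOf κ Φ t p O (KS.gT mkP gx) (KS.fT mkP fx) hv)).hF 1 : ℤ) + 1) / 2 + (5 * ((((KS0.Rlev0 κ Φ t p O.merged mkP + KS0.reach0 t O.merged mkP) - 1 : ℕ)) : ℤ) + 15)) + ((fcellsV κ Φ t p O.merged (KS.gT mkP gx κ Φ t p O.merged) (KS.fT mkP fx κ Φ t p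 O.merged) (cOf κ Φ t p O (KS.gT mkP gx) (KS.fT mkP fx) cv) (hOf κ Φ t p O (KS.gT mkP gx) (KS.fT mkP fx) hv)).hF 1 : ℤ) + 14 * (KS.u₀A κ Φ t p O.merged (KS.gT mkP gx κ Φ t p O.merged) (KS.fT mkP fx κ Φ t p O.merged)) ≤ 2 * ((fcellsV κ Φ t p O.merged (KS.gT mkP gx κ Φ t p O.merged) (KS.fT mkP fx κ Φ t p O.merged) (cOf κ Φ t p O (KS.gT mkP gx) (KS.fT mkP fx) cv) (hOf κ Φ t p O (KS.gT mkP gx) (KS.fT mkP fx) hv)).c 1 : ℤ) + 2 * ((KS.bwY κ Φ t p O.merged (KS.gT mkP gx κ Φ t p O.merged) (KS.fT mkP fx κ Φ t p O.merged)) : ℤ))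
    (hwinYx : 2 * ((((fcellsV κ Φ t p O.merged (KS.gT mkP gx κ Φ t p O.merged) (KS.fT mkP fx κ Φ t p O.merged) (cOf κ Φ t p O (KS.gT mkP gx) (KS.fT mkP fx) cv) (hOf κ Φ t p O (KS.gT mkP gx) (KS.fT mkP fx) hv)).hF 1 : ℤ) + 1) / 2 + (5 * ((((KS0.Rlev0 κ Φ t p O.merged mkP + KS0.reach0 t O.merged mkP) - 1 : ℕ)) : ℤ) + 15)) + ((fcellsV κ Φ t p O.merged (KS.gT mkP gx κ Φ t p O.merged) (KS.fT mkP fx κ Φ t p O.merged) (cOf κ Φ t p O (KS.gT mkP gx) (KS.fT mkP fx) cv) (hOf κ Φ t p O (KS.gT mkP gx) (KS.fT mkP fx) hv)).hF 1 : ℤ) + 24 * (KS.u₀A κ Φ t p O.merged (KS.gT mkP gx κ Φ t p O.merged) (KS.fT mkP fx κ Φ t p O.merged)) + 10 ≤ 2 * ((fcellsV κ Φ t p O.merged (KS.gT mkP gx κ Φ t p O.merged) (KS.fT mkP fx κ Φ t p O.merged) (cOf κ Φ t p O (KS.gT mkP gx) (KS.fT mkP fx) cv) (hOf κ Φ t p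 O (KS.gT mkP gx) (KS.fT mkP fx) hv)).c 1 : ℤ) + 2 * ((KS.bwY κ Φ t p O.merged (KS.gT mkP gx κ Φ t p O.merged) (KS.fT mkP fx κ Φ t p O.merged)) : ℤ)) :
    Skelφ.FaceOblRMOF G ((choiceAtQ3V κ Φ t p Pv (KS.gT mkP gx) (KS.fT mkP fx) (SUS ex mx) cv hv BSlot.small3 hC).scheme O q)
      ((choiceAtQ3V κ Φ t p Pv (KS.gT mkP gx) (KS.fT mkP fx) (SUS ex mx) cv hv BSlot.small3 hC).FD O q) Φ.Δ κ.δ₂ := by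
  -- the residual floors at `(O.merged, g, f)` (ResidF2), the slot formula `L′(SUS) = ex + Rex(2ψπ) + 24·rmax′ + 3ψπ + 48` (SlotsS)
  obtain ⟨hRs, hRb0, hRL0, hYb, hb0, hre0, hπXv, hπYv⟩ := floors_of_ge2 hex O.merged (KS.gT mkP gx κ Φ t p O.merged) (KS.fT mkP fx κ Φ t p O.merged)
  have hLp := Lp_SUS_eq κ Φ t p O.merged (KS.gT mkP gx κ Φ t p O.merged) (KS.fT mkP fx κ Φ t p O.merged) ex mx q
  have hexLp := (ex_le_Lp_US κ Φ t p O.merged (KS.gT mkP gx κ Φ t p O.merged) (KS.fT mkP fx κ Φ t p O.merged) ex mx q).1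
  have hψ := ψπ_eq Φ hC O.merged
  -- UNDER PROXIES: `D ≤ k ≤ fatRadius k = ψπ` and `r₀0 (X + D) ≤ r₀0 X + D` — the `+ D` radii and the rim radius `D + fatRadius k` fit in `L′` without a new floor
  have hDψ : D ≤ ψπ Φ p O.merged := by rw [hψ]; exact hDk.trans (Skelφ.le_fatRadius Φ.frame hC O.merged.k)
  have hr0D : ∀ X : ℕ, KS0.r₀0 t O.merged mkP (X + D) ≤ KS0.r₀0 t O.merged mkP X + D := fun X => by unfold KS0.r₀0; omega
  have hRbD := hr0D (O.merged.R (O.merged.scale t (KS.MBF κ Φ t p O.merged cW mkP) (KS.nBF κ Φ t p O.merged cW mkP)))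
  have hRbg := KS0.r₀0_ge t O.merged mkP (O.merged.R (O.merged.toDataN.scale t (KS.MBF κ Φ t p O.merged cW mkP) (KS.nBF κ Φ t p O.merged cW mkP)))
  have hRLg := KS0.r₀0_ge t O.merged mkP (RLD κ Φ t p O.merged (KS.gT mkP gx κ Φ t p O.merged) (KS.fT mkP fx κ Φ t p O.merged))
  have hRLD := hr0D (RLD κ Φ t p O.merged (KS.gT mkP gx κ Φ t p O.merged) (KS.fT mkP fx κ Φ t p O.merged))
  have eRL : (RL κ Φ t p O (KS.gT mkP gx) (KS.fT mkP fx)) = (RLD κ Φ t p O.merged (KS.gT mkP gx κ Φ t p O.merged) (KS.fT mkP fx κ Φ t p O.merged)) := rfl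
  have er₀ : ∀ (A : ℤ) (X : ℕ), (KS0.kit0 t O.merged mkP A X).r₀ = X := fun _ _ => rfl
  have eRex : ∀ X : ℕ, ((SUS ex mx) κ Φ t p O.merged (KS.gT mkP gx κ Φ t p O.merged) (KS.fT mkP fx κ Φ t p O.merged) q).Rex X = Rex κ Φ (mRS κ Φ t p O.merged (KS.gT mkP gx κ Φ t p O.merged) (KS.fT mkP fx κ Φ t p O.merged) (mx κ Φ t p O.merged (KS.gT mkP gx κ Φ t p O.merged) (KS.fT mkP fx κ Φ t p O.merged))) q X := fun _ => rfl
  have hmono : Rex κ Φ (mRS κ Φ t p O.merged (KS.gT mkP gx κ Φ t p O.merged) (KS.fT mkP fx κ Φ t p O.merged) (mx κ Φ t p O.merged (KS.gT mkP gx κ Φ t p O.merged) (KS.fT mkP fx κ Φ t p O.merged))) q (D + Skelφ.fatRadius Φ.frame hC O.merged.k) ≤ Rex κ Φ (mRS κ Φ t p O.merged (KS.gT mkP gx κ Φ t p O.merged) (KS.fT mkP fx κ Φ t p O.merged) (mx κ Φ t p O.merged (KS.gT mkP gx κ Φ t p O.merged) (KS.fT mkP fx κ Φ t p O.merged))) q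 (2 * ψπ Φ p O.merged) :=
    Rex_mono κ Φ _ q (by rw [← hψ]; omega)
  -- the box row `4·K·(R′0+2) ≤ M_L` (`K = 40·Kq`, ResidF `hR0F_of_ge`) at the raised index
  have hMR0v :  4 * Neg.K κ * (KS0.R'0 κ Φ t p O.merged mkP + 2) ≤ ML κ Φ t p O.merged (KS.gT mkP gx κ Φ t p O.merged) := by
    have h := (hR0F_of_ge hgx O.merged).1
    have h4 : 4 * Neg.K κ ≤ 22000 * Neg.Kq κ := by rw [Neg.K_eq]; omega
    exact (Nat.mul_le_mul_right (KS0.R'0 κ Φ t p O.merged mkP + 2) h4).trans h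
  -- the slot rows at `r := L′(SUS ex mx)`
  have hL'v :  1 ≤ (Skelφ.Prm.Lp ((SUS ex mx) κ Φ t p O.merged (KS.gT mkP gx κ Φ t p O.merged) (KS.fT mkP fx κ Φ t p O.merged) q)) := by omega
  have hRlrv :  (RL κ Φ t p O (KS.gT mkP gx) (KS.fT mkP fx)) + D ≤ (Skelφ.Prm.Lp ((SUS ex mx) κ Φ t p O.merged (KS.gT mkP gx κ Φ t p O.merged) (KS.fT mkP fx κ Φ t p O.merged) q)) := by rw [eRL]; omega
  have hr₂Rv :  (RL κ Φ t p O (KS.gT mkP gx) (KS.fT mkP fx)) + D ≤ (Skelφ.Prm.Lp ((SUS ex mx) κ Φ t p O.merged (KS.gT mkP gx κ Φ t p O.merged) (KS.fT mkP fx κ Φ t p O.merged) q)) := by rw [eRL]; omega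
  have hRb₀v :  (KS0.kit0 t O.merged mkP ((((Mu O.merged)) : ℤ) + 2) (KS0.r₀0 t O.merged mkP (O.merged.R (O.merged.scale t (KS.MBF κ Φ t p O.merged cW mkP) (KS.nBF κ Φ t p O.merged cW mkP)) + D))).r₀ ≤ (Skelφ.Prm.Lp ((SUS ex mx) κ Φ t p O.merged (KS.gT mkP gx κ Φ t p O.merged) (KS.fT mkP fx κ Φ t p O.merged) q)) := by rw [er₀]; omega
  have hr₁Rv :  (O.merged.R (O.merged.scale t (KS.MBF κ Φ t p O.merged cW mkP) (KS.nBF κ Φ t p O.merged cW mkP)) + D) ≤ (Skelφ.Prm.Lp ((SUS ex mx) κ Φ t p O.merged (KS.gT mkP gx κ Φ t p O.merged) (KS.fT mkP fx κ Φ t p O.merged) q)) := by omega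
  have hRr₀v :  (KS0.kit0 t O.merged mkP (((((Mu O.merged)) + 1 : ℕ) : ℤ) * ((shearUnit (nL κ Φ t p O.merged (KS.gT mkP gx κ Φ t p O.merged) (KS.fT mkP fx κ Φ t p O.merged)) (prFA κ Φ t p O.merged (KS.gT mkP gx κ Φ t p O.merged) (KS.fT mkP fx κ Φ t p O.merged)).h) : ℤ) + 1) (KS0.r₀0 t O.merged mkP ((RL κ Φ t p O (KS.gT mkP gx) (KS.fT mkP fx)) + D))).r₀ ≤ (Skelφ.Prm.Lp ((SUS ex mx) κ Φ t p O.merged (KS.gT mkP gx κ Φ t p O.merged) (KS.fT mkP fx κ Φ t p O.merged) q)) := by rw [er₀, eRL]; omega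
  have hRsrv :  (KS.Rs t O.merged mkP) ≤ (Skelφ.Prm.Lp ((SUS ex mx) κ Φ t p O.merged (KS.gT mkP gx κ Φ t p O.merged) (KS.fT mkP fx κ Φ t p O.merged) q)) := by omega
  have hρrv :  (D + Skelφ.fatRadius Φ.frame hC O.merged.k) ≤ (Skelφ.Prm.Lp ((SUS ex mx) κ Φ t p O.merged (KS.gT mkP gx κ Φ t p O.merged) (KS.fT mkP fx κ Φ t p O.merged) q)) := by rw [← hψ]; omega
  have hR₁bv :  ((SUS ex mx κ Φ t p O.merged (KS.gT mkP gx κ Φ t p O.merged) (KS.fT mkP fx κ Φ t p O.merged) q).Rex (D + Skelφ.fatRadius Φ.frame hC O.merged.k)) ≤ (Skelφ.Prm.Lp ((SUS ex mx) κ Φ t p O.merged (KS.gT mkP gx κ Φ t p O.merged) (KS.fT mkP fx κ Φ t p O.merged) q)) - (KS0.kit0 t O.merged mkP ((((Mu O.merged)) : ℤ) + 2) (KS0.r₀0 t O.merged mkP (O.merged.R (O.merged.scale t (KS.MBF κ Φ t p O.merged cW mkP) (KS.nBF κ Φ t p O.merged cW mkP)) + D))).r₀ := by rw [eRex, er₀];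 omega
  have hR₁rv :  ((SUS ex mx κ Φ t p O.merged (KS.gT mkP gx κ Φ t p O.merged) (KS.fT mkP fx κ Φ t p O.merged) q).Rex (D + Skelφ.fatRadius Φ.frame hC O.merged.k)) ≤ (Skelφ.Prm.Lp ((SUS ex mx) κ Φ t p O.merged (KS.gT mkP gx κ Φ t p O.merged) (KS.fT mkP fx κ Φ t p O.merged) q)) - (KS0.kit0 t O.merged mkP (((((Mu O.merged)) + 1 : ℕ) : ℤ) * ((shearUnit (nL κ Φ t p O.merged (KS.gT mkP gx κ Φ t p O.merged) (KS.fT mkP fx κ Φ t p O.merged)) (prFA κ Φ t p O.merged (KS.gT mkP gx κ Φ t p O.merged) (KS.fT mkP fx κ Φ t p O.merged)).h) : ℤ) + 1) (KS0.r₀0 t O.merged mkP ((RL κ Φ t p O (KS.gT mkP gx) (KS.fT mkP fx)) + D))).r₀ := by rw [eRex, er₀, eRL]; omega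
  have hr₀Lv :  (KS0.kit0 t O.merged mkP (((((Mu O.merged)) + 1 : ℕ) : ℤ) * (prFA κ Φ t p O.merged (KS.gT mkP gx κ Φ t p O.merged) (KS.fT mkP fx κ Φ t p O.merged)).D + 1) (KS0.r₀0 t O.merged mkP (Skelφ.Prm.Lp ((SUS ex mx) κ Φ t p O.merged (KS.gT mkP gx κ Φ t p O.merged) (KS.fT mkP fx κ Φ t p O.merged) q)))).r₀ + 1 ≤ 2 * (Skelφ.Prm.Lp ((SUS ex mx) κ Φ t p O.merged (KS.gT mkP gx κ Φ t p O.merged) (KS.fT mkP fx κ Φ t p O.merged) q)) := by rw [er₀]; unfold KS0.r₀0; omega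
  have hYbrv :  KS.YbF κ Φ t p O.merged cW mkP (KS.gT mkP gx κ Φ t p O.merged) (KS.fT mkP fx κ Φ t p O.merged) ≤ (Skelφ.Prm.Lp ((SUS ex mx) κ Φ t p O.merged (KS.gT mkP gx κ Φ t p O.merged) (KS.fT mkP fx κ Φ t p O.merged) q)) := by omega
  have hrXv :  KS.πBudX κ Φ t p O.merged cW mkP (KS.gT mkP gx κ Φ t p O.merged) (KS.fT mkP fx κ Φ t p O.merged) ≤ (Skelφ.Prm.Lp ((SUS ex mx) κ Φ t p O.merged (KS.gT mkP gx κ Φ t p O.merged) (KS.fT mkP fx κ Φ t p O.merged) q)) := by omega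
  have hrYv :  KS.πBudY κ Φ t p O.merged cW mkP (KS.gT mkP gx κ Φ t p O.merged) (KS.fT mkP fx κ Φ t p O.merged) ≤ (Skelφ.Prm.Lp ((SUS ex mx) κ Φ t p O.merged (KS.gT mkP gx κ Φ t p O.merged) (KS.fT mkP fx κ Φ t p O.merged) q)) := by omega
  exact faceOblRM_frmBVC₆Px (r := (Skelφ.Prm.Lp ((SUS ex mx) κ Φ t p O.merged (KS.gT mkP gx κ Φ t p O.merged) (KS.fT mkP fx κ Φ t p O.merged) q))) mk mkP cW gx fx hgx hfx ex mx hmx hAt hP hDk hnK hDnL hnBF hRK hp0 hp1 hMR0v hPx Lf hCF hL'v hRlrv (Lf κ.K₀) hRb₀v hr₁Rv hRr₀v hr₂Rv hRsrv hρrv hR₁bv hR₁rv hr₀Lv hc600 hrXv hrYv hLf hYbrv le_rfl hcapX hwinX hcapY hwinY hwinYx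

end NegB

end PlanarSkeletonFrmFrom

end Summit.CriticalPhenomena.PercolationContinuityZ3.Theorems.Transplant

end
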